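import Summits.ResolutionOfSingularities.ResolutionOfSingularities.Theses.FrobeniusClosing

/-!
# Crux `ClosingReduction` (stmt-ResolutionOfSingularities-16347) — birth skeleton (BC3), line `birth`

Route `ResolutionOfSingularities/FrobeniusClosing`, crux #5 (rank 5, difficulty L):
`ClosingReduction := NoPeriodicIsolatedAtom → BoundedMilnor → IsolatedForcedTermination` — the
CLOSING REDUCTION: if no chain of isolated multiplicity-`p` states of the point-blow-up dynamics over
a field ALGEBRAIC over `𝔽_p` returns to a pair-isomorphic state (the certificate, rank 2) and the
Milnor-type colength `μ` stays bounded along every infinite isolated chain over a perfect field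
(rank 4), then there is no infinite isolated chain at all (the target `IsolatedForcedTermination`).

## The cut (four named stubs; `ClosingReduction_of` proved)

The route header's foreseen two-layer split "ClosingReduction ⇐ PairDeterminacy (BGM for the pair
group) → ArenaConstructible (T_β constructible, exact on classes) → ClosingReduction (with the
support ClosingLemma)", typed, plus the unwinding step the item's why-might-fail and the route
review (CLOSING-SKETCH.md on the item) single out:

* `stub_pairDeterminacy : PairDeterminacy` — FINITE DETERMINACY FOR THE PAIR GROUP: over an
  algebraically closed field of characteristic `p`, an isolated multiplicity-`p` state `c` with
  `μ(c) ≤ β` is pair-isomorphic to every state with the same cleaned `(2β+2)`-jet. Source: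
  Boubakri–Greuel–Markwig Cor. 2.4(1) (vendored named fact
  `Literature.AlgebraicGeometry.Resolution.BoubakriGreuelMarkwig.Cor24`: `μ < ∞ ⇒` right
  `(2μ − ord + 2)`-determined, `K` algebraically closed, `n ≥ 2`; right equivalence is contained in
  the pair group `(φ, v^p·, +g^p)`; `ord ≥ p ≥ 2` for multiplicity-`p` states so `2μ − ord + 2 ≤ 2β`;
  `n = 1` is a one-variable Hensel argument since cleaned orders are prime to `p`). Size M.
  Why it might fail: only the re-derivation leak named on the item (BGM is printed for right
  equivalence over `K = K̄`; the stub asks nothing more).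
* `stub_arenaConstructible : PairDeterminacy → ArenaConstructible` — THE ARENA (load-bearing for
  the "closing" mechanism): for every `(p, n, β)` there is ONE correspondence `T ⊆ 𝔸ᴺ × 𝔸ᴺ`,
  constructible and defined over `𝔽_p` (data `(N, k, P, Q)` in exactly the format the support item
  `ClosingLemma` consumes, plus the list `e` of recorded monomials), such that (ENCODE) over every
  perfect field of characteristic `p` a bounded isolated successor pair `BddSucc` maps to a `T`-edge
  between the cleaned-coefficient codes, and (DECODE) over every algebraically closed field of
  characteristic `p` a `T`-edge between codes comes from a bounded isolated successor pair of the
  decoded polynomial states. Content: `W_β` = cleaned jets with `μ ≤ β`, order `≥ p` (constructible: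
  `μ ≤ β ⟺` a rank condition on `(j(f) + 𝔪^{β+1})/𝔪^{β+1}` by Nakayama); truncated pair group and
  successor map are polynomial over `ℤ/p`; `T` := Chevalley image (Mathlib
  `PrimeSpectrum.isConstructible_comap_image`); exactness on classes = `PairDeterminacy` (the
  hypothesis) + transport of successor points along pair isomorphisms. Size L. Why it might fail:
  the item's second leak — if ENCODE needs witnesses only available over `K̄` the membership is still
  decided in `K` (fine), but if the successor of a state and of its jet-truncation are related only
  after an extension of the residue field of the NEW point, `BddSucc` must be refined (arena
  refinement, as the item says).
* `stub_unwinding : Unwinding` — UNWINDING: over a field algebraic over `𝔽_p`, a finite chain of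
  bounded isolated successor pairs `c₀ → c₁ → ⋯ → c_r = c₀` (`r > 0`, each step an honest blow-up
  move followed by a pair isomorphism) is realised by an HONEST run `d₀, i, t` with all states
  `0..r'` isolated of multiplicity `p` and `PairIso (run 0) (run r')` — exactly the configuration
  `NoPeriodicIsolatedAtom` forbids. Content: a pair isomorphism `(φ, v, g)` induces an isomorphism of
  the blown-up atoms mapping rational points of the exceptional divisor to rational points
  (`g ∈ 𝔪` automatically since `ord g^p ≥ p`, so transported successor points stay in the `u`-charts
  — route review), and `Isol`/`MultP`/`μ` are `PairIso`-invariant; induction on `r`. Size M. Why it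
  might fail: transport changes the chart word, which the statement allows (`i`, `t` are outputs).
* `stub_closingLemma : ClosingLemma` — the route's support item stmt-ResolutionOfSingularities-16348
  BY NAME (twisted Lang–Weil, Varshavsky 2014 Thm 0.1/Cor 0.2 = vendored fact
  `Literature.AlgebraicGeometry.FiniteFields.Varshavsky2014TwistedLangWeil`, + Noetherian induction
  over dead ends); listed as a stub so that the composition below has exactly the registered stubs
  as hypotheses. Size M (given the vendored fact).
* `ClosingReduction_of : Sig.stub_pairDeterminacy → Sig.stub_arenaConstructible → Sig.stub_unwinding →
  ClosingLemma → ClosingReduction` (`Sig.stub_<name>` = the stub statements by name, the registered-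
  signature convention; `ClosingLemma` is the route's support item) is PROVED (no `sorry` in its own
  term): an infinite isolated
  multiplicity-`p` run over a perfect `κ` has `μ ≤ β` (`BoundedMilnor`), hence is an infinite chain of
  `BddSucc p n β κ` (reflexivity of `PairIso`), hence (ENCODE, `κ` made a `ℤ/p`-algebra by
  `ZMod.algebra`) an infinite `T`-path over `κ`; `ClosingLemma` gives a periodic `T`-path over a
  finite field `F`; push it into `F̄ = AlgebraicClosure F` (algebraically closed AND algebraic over
  `ℤ/p`), DECODE it edge by edge into a periodic `BddSucc`-chain of polynomial states, UNWIND it into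
  an honest run over `F̄` returning to a pair-isomorphic state, and `NoPeriodicIsolatedAtom` (at the
  field `F̄`, algebraic over `𝔽_p`) is contradicted. The three route items are unfolded to the named
  dynamics below by `Iff.rfl` (`isolatedForcedTermination_iff`, `boundedMilnor_iff`,
  `noPeriodicIsolatedAtom_iff`), so the composition concludes the crux BY NAME.

Disproof used: none on file for this crux (`ledger crux ls stmt-ResolutionOfSingularities-16347`: no
workfiles before this one; `ledger negatives --problem ResolutionOfSingularities`: nothing on this
route's items). Dead lines: none recorded.
-/

noncomputable section

-- single-problem summit: the doubled namespace component `ResolutionOfSingularities` is forced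
set_option linter.dupNamespace false

open scoped BigOperators Topology Manifold Classical MeasureTheory ProbabilityTheory Matrix InnerProductSpace ComplexConjugate ContinuousMap
open Filter Set Function TopologicalSpace MeasureTheory

open Summit.ResolutionOfSingularities.ResolutionOfSingularities.Theses.FrobeniusClosing
  (ClosingReduction NoPeriodicIsolatedAtom BoundedMilnor IsolatedForcedTermination ClosingLemma)

namespace Summit.ResolutionOfSingularities.ResolutionOfSingularities.Cruxes.ClosingReduction.Lines.Birth

/-! ## The point-blow-up dynamics of the route, NAMED

Verbatim the `let`-bound coefficient calculus shared by `IsolatedForcedTermination`, `BoundedMilnor`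
and `NoPeriodicIsolatedAtom` (route file), one `def` per `let`; the three items unfold to these by
`Iff.rfl` (section "bridges"). States are coefficient functions `c : (Fin n → ℕ) → κ` of
`a = Σ c(A) u^A ∈ κ[[u₁,…,uₙ]]`, the atom being `z^p = a`. -/

section Dynamics

variable (p n : ℕ) (κ : Type) [Field κ]

/-- `clean c`: delete the `p`-th-power monomials of `a` (reduce `a` modulo `κ[[u]]^p`, `κ` perfect).
[folklore] -/
def clean (c : (Fin n → ℕ) → κ) : (Fin n → ℕ) → κ :=
  fun A => @ite κ (∀ j, p ∣ A j) (Classical.dec _) 0 (c A)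

/-- `bl i c`: chart `i` of the blow-up of the closed point (`u_j ↦ u_i u_j` for `j ≠ i`). [folklore] -/
def bl (i : Fin n) (c : (Fin n → ℕ) → κ) : (Fin n → ℕ) → κ :=
  fun B => @ite κ (Finset.sum (Finset.univ.erase i) (fun j => B j) ≤ B i) (Classical.dec _)
    (c (Function.update B i (B i - Finset.sum (Finset.univ.erase i) (fun j => B j)))) 0

/-- `ord c`: the order (least total degree of a monomial with non-zero coefficient). [folklore] -/
def ord (c : (Fin n → ℕ) → κ) : ℕ :=
  sInf {m : ℕ | ∃ A, c A ≠ 0 ∧ m = Finset.sum Finset.univ (fun j => A j)}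

/-- `dv i s c`: divide by `u_i ^ s`. [folklore] -/
def dv (i : Fin n) (s : ℕ) (c : (Fin n → ℕ) → κ) : (Fin n → ℕ) → κ :=
  fun B => c (Function.update B i (B i + s))

/-- `tr i τ s c`: pass to the closed point `u_j = τ_j` (`j ≠ i`) of the exceptional divisor
(Taylor shift, truncated at the relevant degree). [folklore] -/
def tr (i : Fin n) (τ : Fin n → κ) (s : ℕ) (c : (Fin n → ℕ) → κ) : (Fin n → ℕ) → κ :=
  fun B => Finset.sum (Fintype.piFinset (fun _ : Fin n => Finset.range (B i + s + 1)))
    (fun D => @ite κ (D i = 0) (Classical.dec _) (c (B + D) * Finset.prod (Finset.univ.erase i)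
      (fun j => ((Nat.choose (B j + D j) (B j) : ℕ) : κ) * τ j ^ (D j))) 0)

/-- `step i τ c`: ONE MOVE of the dynamics — clean, blow up the closed point, chart `i`, divide the
strict transform by `u_i ^ p` (when the cleaned order is `≥ p`), translate to the point `τ`, clean.
[folklore] -/
def step (i : Fin n) (τ : Fin n → κ) (c : (Fin n → ℕ) → κ) : (Fin n → ℕ) → κ :=
  clean p n κ (tr n κ i τ (@ite ℕ (p ≤ ord n κ (clean p n κ c)) (Classical.dec _) p 0)
    (dv n κ i (@ite ℕ (p ≤ ord n κ (clean p n κ c)) (Classical.dec _) p 0) (bl n κ i (clean p n κ c))))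

/-- `run c₀ i t m`: the `m`-th state of the run from `c₀` along the chart word `i` and the
translation word `t`. [folklore] -/
def run (c₀ : (Fin n → ℕ) → κ) (i : ℕ → Fin n) (t : ℕ → Fin n → κ) (m : ℕ) : (Fin n → ℕ) → κ :=
  @Nat.rec (fun _ => (Fin n → ℕ) → κ) c₀ (fun m c => step p n κ (i m) (t m) c) m

/-- `ser c ∈ κ[[u₁,…,uₙ]]`: the cleaned series of the state `c`. [folklore] -/
def ser (c : (Fin n → ℕ) → κ) : MvPowerSeries (Fin n) κ :=
  show MvPowerSeries (Fin n) κ from fun A : Fin n →₀ ℕ => clean p n κ c ⇑A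

/-- `pd i f = ∂f/∂u_i` (formal partial derivative, coefficient formula). [folklore] -/
def pd (i : Fin n) (f : MvPowerSeries (Fin n) κ) : MvPowerSeries (Fin n) κ :=
  show MvPowerSeries (Fin n) κ from fun A : Fin n →₀ ℕ => ((A i + 1 : ℕ) : κ) * f (A + Finsupp.single i 1)

/-- `jac c = (∂₁ a, …, ∂ₙ a)`: the Jacobian ideal of the cleaned series. [folklore] -/
def jac (c : (Fin n → ℕ) → κ) : Ideal (MvPowerSeries (Fin n) κ) :=
  Ideal.span (Set.range (fun i => pd n κ i (ser p n κ c)))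

/-- `Isol c`: the point is ISOLATED — the Milnor algebra `κ[[u]]/jac` is finite over `κ`
(= `BoubakriGreuelMarkwig.IsIsolated (ser c)` up to unfolding). [cite: BoubakriGreuelMarkwig2010, §1 (p. 3)] -/
def Isol (c : (Fin n → ℕ) → κ) : Prop :=
  Module.Finite κ (MvPowerSeries (Fin n) κ ⧸ jac p n κ c)

/-- `MultP c`: MULTIPLICITY `p` — the cleaned series is non-zero of order `≥ p`. [folklore] -/
def MultP (c : (Fin n → ℕ) → κ) : Prop :=
  (∃ A, clean p n κ c A ≠ 0) ∧ ∀ A, clean p n κ c A ≠ 0 → p ≤ Finset.sum Finset.univ (fun j => A j)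

/-- `mu c = dim_κ κ[[u]]/jac`: the Milnor-type colength (`Module.finrank`, so `0` if infinite; read
with `Isol`). [cite: BoubakriGreuelMarkwig2010, §1 (p. 3)] -/
def mu (c : (Fin n → ℕ) → κ) : ℕ :=
  Module.finrank κ (MvPowerSeries (Fin n) κ ⧸ jac p n κ c)

/-- `PairIso c c'`: the pairs `(κ[[u]], [a])`, `(κ[[u]], [a'])` are isomorphic — a `κ`-automorphism
`φ` of `κ[[u]]`, a unit `v` and a series `g` with `φ(a) = v^p a' + g^p` (the hypersurfaces `z^p = a`,
`z^p = a'` are then isomorphic by `z ↦ (z - g)/v`). [folklore] -/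
def PairIso (c c' : (Fin n → ℕ) → κ) : Prop :=
  ∃ (φ : MvPowerSeries (Fin n) κ ≃ₐ[κ] MvPowerSeries (Fin n) κ) (v g : MvPowerSeries (Fin n) κ),
    IsUnit v ∧ φ (ser p n κ c) = v ^ p * ser p n κ c' + g ^ p

end Dynamics

/-! ## The objects of the cut -/

section Cut

/-- `BddSucc p n β K c c'` — BOUNDED ISOLATED SUCCESSOR UP TO PAIR-ISOMORPHISM: `c` is an isolated
multiplicity-`p` state with `μ(c) ≤ β`; for some chart `i` and translation `τ ∈ Kⁿ` the honest
successor `step i τ c` is again isolated of multiplicity `p` with `μ ≤ β`; and `c'` (also isolated,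
multiplicity `p`, `μ ≤ β`) is pair-isomorphic to that successor. The edge relation of the ARENA
`W_β` of the route's proof plan (i), before passing to jets. [folklore] -/
def BddSucc (p n β : ℕ) (K : Type) [Field K] (c c' : (Fin n → ℕ) → K) : Prop :=
  ∃ (i : Fin n) (τ : Fin n → K),
    (Isol p n K c ∧ MultP p n K c ∧ mu p n K c ≤ β) ∧
    (Isol p n K (step p n K i τ c) ∧ MultP p n K (step p n K i τ c) ∧
      mu p n K (step p n K i τ c) ≤ β) ∧
    (Isol p n K c' ∧ MultP p n K c' ∧ mu p n K c' ≤ β) ∧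
    PairIso p n K (step p n K i τ c) c'

/-- `code e c ∈ Kᴺ`: the cleaned coefficients of the state `c` at the recorded monomials
`e : Fin N → (Fin n → ℕ)` (for the arena: an enumeration of the non-`p`-th-power monomials of total
degree `≤ 2β + 2`, the determinacy bound). [folklore] -/
def code (p n : ℕ) (K : Type) [Field K] {N : ℕ} (e : Fin N → (Fin n → ℕ)) (c : (Fin n → ℕ) → K) :
    Fin N → K :=
  fun s => clean p n K c (e s)

/-- `decode e x`: the polynomial state with coefficient `x s` at the monomial `e s` and `0` at the
monomials not recorded. [folklore] -/
def decode (n : ℕ) (K : Type) [Field K] {N : ℕ} (e : Fin N → (Fin n → ℕ)) (x : Fin N → K) :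
    (Fin n → ℕ) → K :=
  fun A => @dite K (∃ s, e s = A) (Classical.dec _) (fun h => x (Classical.choose h)) (fun _ => 0)

/-- `Edge p P Q K x y`: `(x, y) ∈ T(K)` for the constructible correspondence
`T = ⋃ⱼ V(P j) ∖ V(Q j) ⊆ 𝔸ᴺ × 𝔸ᴺ` defined over `ℤ/p` — VERBATIM the edge predicate of the route's
support item `ClosingLemma` (so that `T`-paths here are `ClosingLemma`'s paths definitionally).
[folklore] -/
def Edge (p : ℕ) {N k : ℕ} (P Q : Fin k → Finset (MvPolynomial (Fin N ⊕ Fin N) (ZMod p)))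
    (K : Type) [Field K] [Algebra (ZMod p) K] (x y : Fin N → K) : Prop :=
  ∃ j, (∀ f ∈ P j, MvPolynomial.aeval (Sum.elim x y) f = 0) ∧
    ∃ g ∈ Q j, MvPolynomial.aeval (Sum.elim x y) g ≠ 0

/-- **`PairDeterminacy`** (statement of `stub_pairDeterminacy`) — finite determinacy for the pair
group: for `p` prime, `n ≥ 1`, `β ∈ ℕ`, `K` an ALGEBRAICALLY CLOSED field of characteristic `p`, an
isolated multiplicity-`p` state `c` with `μ(c) ≤ β` is pair-isomorphic to every state `c'` whose
cleaned coefficients agree with those of `c` in all total degrees `≤ 2β + 2`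
(BGM Cor. 2.4(1): `μ < ∞ ⇒` right `(2μ − ord + 2)`-determined, and `ord ≥ p ≥ 2`).
[cite: BoubakriGreuelMarkwig2010, Cor. 2.4] -/
def PairDeterminacy : Prop :=
  ∀ p : ℕ, p.Prime → ∀ (n β : ℕ) (K : Type) [Field K] [CharP K p] [IsAlgClosed K]
    (c c' : (Fin n → ℕ) → K), 0 < n → Isol p n K c → MultP p n K c → mu p n K c ≤ β →
    (∀ A : Fin n → ℕ, Finset.sum Finset.univ (fun j => A j) ≤ 2 * β + 2 →
      clean p n K c A = clean p n K c' A) →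
    PairIso p n K c c'

/-- **`ArenaConstructible`** (conclusion of `stub_arenaConstructible`) — THE ARENA: for `p` prime,
`n ≥ 1`, `β ∈ ℕ` there are `N`, recorded monomials `e : Fin N → (Fin n → ℕ)` and a constructible
correspondence `T = ⋃_{j<k} V(P j) ∖ V(Q j) ⊆ 𝔸ᴺ × 𝔸ᴺ` with `P j, Q j ⊆ (ℤ/p)[X, Y]` such that
(ENCODE) over every perfect field `K ⊇ ℤ/p`, `BddSucc p n β K c c' → (code e c, code e c') ∈ T(K)`,
and (DECODE) over every algebraically closed `K ⊇ ℤ/p`,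
`(x, y) ∈ T(K) → BddSucc p n β K (decode e x) (decode e y)`. (Chevalley: Mathlib
`PrimeSpectrum.isConstructible_comap_image`; exact on classes by `PairDeterminacy` + transport.)
[cite: BoubakriGreuelMarkwig2010, Cor. 2.4; Varshavsky2014, Thm. 0.1 (the format of `T`)] -/
def ArenaConstructible : Prop :=
  ∀ p : ℕ, p.Prime → ∀ n : ℕ, 0 < n → ∀ β : ℕ,
    ∃ (N k : ℕ) (e : Fin N → (Fin n → ℕ))
      (P Q : Fin k → Finset (MvPolynomial (Fin N ⊕ Fin N) (ZMod p))),
      (∀ (K : Type) [Field K] [Algebra (ZMod p) K] [PerfectField K] (c c' : (Fin n → ℕ) → K),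
          BddSucc p n β K c c' → Edge p P Q K (code p n K e c) (code p n K e c')) ∧
      (∀ (K : Type) [Field K] [Algebra (ZMod p) K] [IsAlgClosed K] (x y : Fin N → K),
          Edge p P Q K x y → BddSucc p n β K (decode n K e x) (decode n K e y))

/-- **`Unwinding`** (statement of `stub_unwinding`) — over a field `K` ALGEBRAIC over `𝔽_p`, a
finite chain `c 0 → c 1 → ⋯ → c r = c 0` (`r > 0`) of bounded isolated successor pairs is realised
by an honest run: a start `d₀`, a chart word `i` and a translation word `t` over `K` and `r' > 0`
with all states `0..r'` isolated of multiplicity `p` and `PairIso (run 0) (run r')` (transport of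
successor points along pair isomorphisms; `Isol`, `MultP`, `μ` are `PairIso`-invariant). [folklore] -/
def Unwinding : Prop :=
  ∀ p : ℕ, p.Prime → ∀ n : ℕ, 0 < n → ∀ (β : ℕ) (K : Type) [Field K] [Algebra (ZMod p) K]
    [Algebra.IsAlgebraic (ZMod p) K] (c : ℕ → (Fin n → ℕ) → K) (r : ℕ), 0 < r → c r = c 0 →
    (∀ m, m < r → BddSucc p n β K (c m) (c (m + 1))) →
    ∃ (d₀ : (Fin n → ℕ) → K) (i : ℕ → Fin n) (t : ℕ → Fin n → K) (r' : ℕ), 0 < r' ∧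
      (∀ m, m ≤ r' → Isol p n K (run p n K d₀ i t m) ∧ MultP p n K (run p n K d₀ i t m)) ∧
      PairIso p n K (run p n K d₀ i t 0) (run p n K d₀ i t r')

end Cut

/-! ## Bridges: the three route items ARE statements about the named dynamics (definitional) -/

/-- `IsolatedForcedTermination` unfolded to the named dynamics. [folklore] -/
theorem isolatedForcedTermination_iff :
    IsolatedForcedTermination ↔
      ∀ p : ℕ, p.Prime → ∀ n : ℕ, 0 < n → ∀ (κ : Type) [Field κ] [CharP κ p] [PerfectField κ]
        (c₀ : (Fin n → ℕ) → κ) (i : ℕ → Fin n) (t : ℕ → Fin n → κ),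
        ¬ (∀ m, Isol p n κ (run p n κ c₀ i t m) ∧ MultP p n κ (run p n κ c₀ i t m)) :=
  Iff.rfl

/-- `BoundedMilnor` unfolded to the named dynamics. [folklore] -/
theorem boundedMilnor_iff :
    BoundedMilnor ↔
      ∀ p : ℕ, p.Prime → ∀ n : ℕ, 0 < n → ∀ (κ : Type) [Field κ] [CharP κ p] [PerfectField κ]
        (c₀ : (Fin n → ℕ) → κ) (i : ℕ → Fin n) (t : ℕ → Fin n → κ),
        (∀ m, Isol p n κ (run p n κ c₀ i t m) ∧ MultP p n κ (run p n κ c₀ i t m)) →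
          ∃ β : ℕ, ∀ m, mu p n κ (run p n κ c₀ i t m) ≤ β :=
  Iff.rfl

/-- `NoPeriodicIsolatedAtom` unfolded to the named dynamics. [folklore] -/
theorem noPeriodicIsolatedAtom_iff :
    NoPeriodicIsolatedAtom ↔
      ∀ p : ℕ, p.Prime → ∀ n : ℕ, 0 < n → ∀ (κ : Type) [Field κ] [Algebra (ZMod p) κ]
        [Algebra.IsAlgebraic (ZMod p) κ] (c₀ : (Fin n → ℕ) → κ) (i : ℕ → Fin n) (t : ℕ → Fin n → κ)
        (r : ℕ), 0 < r →
        (∀ m, m ≤ r → Isol p n κ (run p n κ c₀ i t m) ∧ MultP p n κ (run p n κ c₀ i t m)) →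
          ¬ PairIso p n κ (run p n κ c₀ i t 0) (run p n κ c₀ i t r) :=
  Iff.rfl

/-- `PairIso` is reflexive (`φ = id`, `v = 1`, `g = 0`; `p ≠ 0`). [folklore] -/
theorem PairIso.refl {p : ℕ} (hp : p ≠ 0) (n : ℕ) (κ : Type) [Field κ] (c : (Fin n → ℕ) → κ) :
    PairIso p n κ c c :=
  ⟨AlgEquiv.refl, 1, 0, isUnit_one, by simp [zero_pow hp]⟩

/-- An infinite isolated multiplicity-`p` run with `μ ≤ β` is an infinite `BddSucc p n β`-chain
(honest successor, identity pair isomorphism). [folklore] -/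
theorem bddSucc_run {p : ℕ} (hp : p.Prime) (n β : ℕ) (κ : Type) [Field κ] (c₀ : (Fin n → ℕ) → κ)
    (i : ℕ → Fin n) (t : ℕ → Fin n → κ)
    (hrun : ∀ m, Isol p n κ (run p n κ c₀ i t m) ∧ MultP p n κ (run p n κ c₀ i t m))
    (hβ : ∀ m, mu p n κ (run p n κ c₀ i t m) ≤ β) (m : ℕ) :
    BddSucc p n β κ (run p n κ c₀ i t m) (run p n κ c₀ i t (m + 1)) :=
  ⟨i m, t m, ⟨(hrun m).1, (hrun m).2, hβ m⟩,
    ⟨(hrun (m + 1)).1, (hrun (m + 1)).2, hβ (m + 1)⟩,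
    ⟨(hrun (m + 1)).1, (hrun (m + 1)).2, hβ (m + 1)⟩,
    PairIso.refl hp.ne_zero n κ _⟩

/-- `T`-edges are preserved under an extension `F ⊆ L` of `ℤ/p`-fields (the polynomials have
coefficients in `ℤ/p`; `F → L` is injective). Used to push `ClosingLemma`'s periodic path over a
finite field `F` into `F̄`. [folklore] -/
theorem Edge.map {p N k : ℕ} (P Q : Fin k → Finset (MvPolynomial (Fin N ⊕ Fin N) (ZMod p)))
    {F L : Type} [Field F] [Algebra (ZMod p) F] [Field L] [Algebra (ZMod p) L] [Algebra F L]
    [IsScalarTower (ZMod p) F L] {x y : Fin N → F} (h : Edge p P Q F x y) :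
    Edge p P Q L (algebraMap F L ∘ x) (algebraMap F L ∘ y) := by
  obtain ⟨j, hP, g, hg, hg0⟩ := h
  have key : ∀ f : MvPolynomial (Fin N ⊕ Fin N) (ZMod p),
      MvPolynomial.aeval (Sum.elim (algebraMap F L ∘ x) (algebraMap F L ∘ y)) f =
        algebraMap F L (MvPolynomial.aeval (Sum.elim x y) f) := fun f => by
    rw [← Sum.comp_elim, MvPolynomial.aeval_algebraMap_apply]
  refine ⟨j, fun f hf => ?_, g, hg, ?_⟩
  · rw [key, hP f hf, map_zero]
  · rw [key]
    intro h0
    exact hg0 ((algebraMap F L).injective (by rw [h0, map_zero]))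

/-! ## The stub STATEMENTS by name (`Sig.stub_<name>`, the registered-signature convention of birth
skeletons: the composition `ClosingReduction_of` takes exactly these — and the route's support item
`ClosingLemma` — as hypotheses) -/

/-- Statement of `stub_pairDeterminacy`. [cite: BoubakriGreuelMarkwig2010, Cor. 2.4] -/
def Sig.stub_pairDeterminacy : Prop := PairDeterminacy

/-- Statement of `stub_arenaConstructible`: the arena exists GIVEN pair determinacy.
[cite: BoubakriGreuelMarkwig2010, Cor. 2.4; Varshavsky2014, Thm. 0.1] -/
def Sig.stub_arenaConstructible : Prop := PairDeterminacy → ArenaConstructible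

/-- Statement of `stub_unwinding`. [folklore] -/
def Sig.stub_unwinding : Prop := Unwinding

/-! ## The stubs -/

/-- **STUB (size M).** Finite determinacy for the pair group — see `PairDeterminacy`.
[cite: BoubakriGreuelMarkwig2010, Cor. 2.4] -/
theorem stub_pairDeterminacy : PairDeterminacy := by
  sorry

/-- **STUB (load-bearing, size L).** The arena: a constructible `𝔽_p`-correspondence on cleaned
`(2β+2)`-jets encoding (over perfect fields) and decoding (over algebraically closed fields) the
bounded isolated successor relation, GIVEN pair determinacy — see `ArenaConstructible`.
[cite: BoubakriGreuelMarkwig2010, Cor. 2.4; Varshavsky2014, Thm. 0.1] -/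
theorem stub_arenaConstructible (h : PairDeterminacy) : ArenaConstructible := by
  sorry

/-- **STUB (size M).** Unwinding a returning chain of bounded isolated successor pairs into an
honest run returning to a pair-isomorphic state — see `Unwinding`. [folklore] -/
theorem stub_unwinding : Unwinding := by
  sorry

/-- **STUB (size M given the vendored twisted Lang–Weil fact) = the route's support item
`ClosingLemma` (stmt-ResolutionOfSingularities-16348) by name.**
[cite: Varshavsky2014, Thm. 0.1 and Cor. 0.2; Hrushovski2004, Cor. 1.2] -/
theorem stub_closingLemma : ClosingLemma := by
  sorry

/-! ## The composition (kernel-checked; no `sorry` in its own term) -/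

/-- **`ClosingReduction` from the four stub statements** — the assembly, PROVED. Given the
certificate `NoPeriodicIsolatedAtom`, the bound `BoundedMilnor` and an infinite isolated
multiplicity-`p` run over a perfect field `κ` of characteristic `p`: `μ ≤ β` along the run; the run
is an infinite `BddSucc p n β κ`-chain; ENCODE makes it an infinite `T`-path over `κ`;
`ClosingLemma` gives a periodic `T`-path over a finite field `F`; pushed into `F̄` and DECODED it is
a periodic chain of bounded isolated successor pairs; UNWINDING realises it as an honest run over
`F̄` (algebraic over `𝔽_p`) returning to a pair-isomorphic state; `NoPeriodicIsolatedAtom` says no.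
[cite: Varshavsky2014, Thm. 0.1; BoubakriGreuelMarkwig2010, Cor. 2.4] -/
theorem ClosingReduction_of :
    Sig.stub_pairDeterminacy → Sig.stub_arenaConstructible → Sig.stub_unwinding → ClosingLemma →
      ClosingReduction := by
  intro hD hA hU hCL hNP hB
  rw [isolatedForcedTermination_iff]
  intro p hp n hn κ _ _ _ c₀ i t hrun
  obtain ⟨β, hβ⟩ := boundedMilnor_iff.1 hB p hp n hn κ c₀ i t hrun
  obtain ⟨N, k, e, P, Q, henc, hdec⟩ := hA hD p hp n hn β
  letI : Algebra (ZMod p) κ := ZMod.algebra κ p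
  have path : ∀ m, Edge p P Q κ (code p n κ e (run p n κ c₀ i t m))
      (code p n κ e (run p n κ c₀ i t (m + 1))) :=
    fun m => henc κ _ _ (bddSucc_run hp n β κ c₀ i t hrun hβ m)
  obtain ⟨F, instF, instA, instFin, w, r, hr, hper, hw⟩ :=
    hCL p hp N k P Q ⟨κ, inferInstance, inferInstance, fun m => code p n κ e (run p n κ c₀ i t m), path⟩
  haveI : Fact p.Prime := ⟨hp⟩
  haveI : Algebra.IsAlgebraic (ZMod p) (AlgebraicClosure F) :=
    Algebra.IsAlgebraic.trans (ZMod p) F (AlgebraicClosure F)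
  have hw' : ∀ m, Edge p P Q (AlgebraicClosure F) (algebraMap F (AlgebraicClosure F) ∘ w m)
      (algebraMap F (AlgebraicClosure F) ∘ w (m + 1)) :=
    fun m => Edge.map P Q (hw m)
  have h0 : w r = w 0 := by simpa using hper 0
  have hcr : decode n (AlgebraicClosure F) e (algebraMap F (AlgebraicClosure F) ∘ w r) =
      decode n (AlgebraicClosure F) e (algebraMap F (AlgebraicClosure F) ∘ w 0) := by rw [h0]
  obtain ⟨d₀, i', t', r', hr', hgood, hiso⟩ :=
    hU p hp n hn β (AlgebraicClosure F)
      (fun m => decode n (AlgebraicClosure F) e (algebraMap F (AlgebraicClosure F) ∘ w m)) r hr hcr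
      (fun m _ => hdec (AlgebraicClosure F) _ _ (hw' m))
  exact noPeriodicIsolatedAtom_iff.1 hNP p hp n hn (AlgebraicClosure F) d₀ i' t' r' hr' hgood hiso

/-- **The crux `ClosingReduction`, assembled from the four registered stubs** (the skeleton in its
final shape; the only `sorry`s in its closure are the four `stub_*`, none of its own). -/
theorem ClosingReduction_proof : ClosingReduction :=
  ClosingReduction_of stub_pairDeterminacy stub_arenaConstructible stub_unwinding stub_closingLemma

end Summit.ResolutionOfSingularities.ResolutionOfSingularities.Cruxes.ClosingReduction.Lines.Birth

end
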